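import Literature.RepresentationTheory.ModularTensorCategories.SU2FSymKL

/-!
# Unit legs and the duality entry of the `SU(2)_k` F-symbols (direct evaluation)

Topic `Literature/RepresentationTheory/ModularTensorCategories` (definition item `defn-ModularDatum`): the
`PreModularDatum` axioms `F_unit` and `norm_F_dual` for the unitary `SU(2)_k` F-symbols `fSym k`, proved
UNCONDITIONALLY from the closed formulas (the Racah sum degenerates to the single term `z = s`):
* `sixJ_unit_left/mid/right` — `sixJ(0,b,b,c,d,d) = (-1)^{(b+c+d)/2}/√([b+1][d+1])` and its two analogues;
  `sixJ_dual` — `sixJ(a,a,0,a,a,0) = (-1)^a/[a+1]`;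
* `fSym_unit` — `fSym = 1` on the admissible entry when one of `a, b, c` is the unit label;
* `norm_fSym_dual` — `‖fSym(a,a,a,a,0,0)‖ = 1/[a+1] = (qdim a)⁻¹`.
[cite: KauffmanLins1994, §9.11–9.12 (closed formulas)] [cite: Kitaev2006, App. E.1.2 (triangle equations), E.2 (duality axiom d_a = |[F^{aāa}_a]_{11}|⁻¹)]
-/

noncomputable section

namespace Literature.RepresentationTheory.ModularTensorCategories.SU2LevelK

open Finset

variable (k : ℕ)

/-- `[0]! = 1`. [folklore] -/
theorem qFactorial_zero : qFactorial k 0 = 1 := by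
  unfold qFactorial; simp

/-- `[n+1]! = [n]! [n+1]`. [folklore] -/
theorem qFactorial_succ (n : ℕ) : qFactorial k (n + 1) = qFactorial k n * qInt k (n + 1) := by
  unfold qFactorial; rw [Finset.prod_range_succ]

/-- `[1] = 1`. [folklore] -/
theorem qInt_one : qInt k 1 = 1 := by
  unfold qInt
  rw [Nat.cast_one, one_mul]
  exact div_self (qInt_pos k (n := 1) le_rfl (by omega) |> fun h => by
    unfold qInt at h; rw [Nat.cast_one, one_mul] at h; exact (div_pos_iff.mp h).elim (fun h => h.2.ne')
      (fun h => h.2.ne))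

/-- The degenerate q-6j symbol with a unit first leg: `sixJ(0,b,b,c,d,d) = (-1)^{(b+c+d)/2}/√([b+1][d+1])`
(the Racah sum has the single term `z = (b+c+d)/2`). [cite: KauffmanLins1994, §9.11–9.12] -/
theorem sixJ_unit_left {b c d : ℕ} (h : Adm k b c d) (hb : b ≤ k) (hd : d ≤ k) :
    sixJ k 0 b b c d d = (-1 : ℝ) ^ ((b + c + d) / 2) / Real.sqrt (qInt k (b + 1) * qInt k (d + 1)) := by
  have g := h
  unfold Adm at g
  unfold sixJ racahSum triangleSq
  simp only
  rw [show (0 + b + b) / 2 = b by omega, show (0 + d + d) / 2 = d by omega,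
    show (0 + b + c + d) / 2 = (b + c + d) / 2 by omega, show (b + b + d + d) / 2 = b + d by omega,
    show max (max b ((b + c + d) / 2)) (max ((b + c + d) / 2) d) = (b + c + d) / 2 by omega,
    show min (min ((b + c + d) / 2) ((b + c + d) / 2)) (b + d) = (b + c + d) / 2 by omega,
    Finset.Icc_self, Finset.sum_singleton]
  rw [show (b + b - 0) / 2 = b by omega, show (0 + b - b) / 2 = 0 by omega, show (d + d - 0) / 2 = d by omega,
    show (0 + d - d) / 2 = 0 by omega, show (b + c + d) / 2 - (b + c + d) / 2 = 0 by omega,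
    show (b + c + d) / 2 - b = (c + d - b) / 2 by omega, show (b + c + d) / 2 - d = (b + c - d) / 2 by omega,
    show b + d - (b + c + d) / 2 = (b + d - c) / 2 by omega, qFactorial_zero, qFactorial_succ k b,
    qFactorial_succ k d]
  have hB : 0 < qFactorial k b := qFactorial_pos k (by omega)
  have hD : 0 < qFactorial k d := qFactorial_pos k (by omega)
  have hqb : 0 < qInt k (b + 1) := qInt_pos k (by omega) (by omega)
  have hqd : 0 < qInt k (d + 1) := qInt_pos k (by omega) (by omega)
  have hx : 0 < qFactorial k ((c + d - b) / 2) := qFactorial_pos k (by omega)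
  have hy : 0 < qFactorial k ((b + d - c) / 2) := qFactorial_pos k (by omega)
  have hz : 0 < qFactorial k ((b + c - d) / 2) := qFactorial_pos k (by omega)
  have hS : 0 < qFactorial k ((b + c + d) / 2 + 1) := qFactorial_pos k (by omega)
  generalize qFactorial k b = B at hB ⊢
  generalize qFactorial k d = D at hD ⊢
  generalize qInt k (b + 1) = qb at hqb ⊢
  generalize qInt k (d + 1) = qd at hqd ⊢
  generalize qFactorial k ((c + d - b) / 2) = x at hx ⊢
  generalize qFactorial k ((b + d - c) / 2) = y at hy ⊢
  generalize qFactorial k ((b + c - d) / 2) = z at hz ⊢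
  generalize qFactorial k ((b + c + d) / 2 + 1) = S at hS ⊢
  rw [show B * 1 * 1 / (B * qb) * (x * y * z / S) * (x * y * z / S) * (D * 1 * 1 / (D * qd)) =
      ((x * y * z / S) / Real.sqrt (qb * qd)) ^ 2 by
    rw [div_pow, Real.sq_sqrt (by positivity)]; field_simp, Real.sqrt_sq (by positivity)]
  field_simp

end Literature.RepresentationTheory.ModularTensorCategories.SU2LevelK

namespace Literature.RepresentationTheory.ModularTensorCategories.SU2LevelK

open Finset

variable (k : ℕ)

/-- Degenerate q-6j symbol with a unit middle leg: `sixJ(a,0,a,c,d,c) = (-1)^{(a+c+d)/2}/√([a+1][c+1])`.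
[cite: KauffmanLins1994, §9.11–9.12] -/
theorem sixJ_unit_mid {a c d : ℕ} (h : Adm k a c d) (ha : a ≤ k) (hc : c ≤ k) :
    sixJ k a 0 a c d c = (-1 : ℝ) ^ ((a + c + d) / 2) / Real.sqrt (qInt k (a + 1) * qInt k (c + 1)) := by
  have g := h
  unfold Adm at g
  unfold sixJ racahSum triangleSq
  simp only
  rw [show (a + 0 + a) / 2 = a by omega, show (0 + c + c) / 2 = c by omega,
    show (a + 0 + c + d) / 2 = (a + c + d) / 2 by omega, show (0 + a + d + c) / 2 = (a + c + d) / 2 by omega,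
    show (a + a + c + c) / 2 = a + c by omega,
    show max (max a ((a + c + d) / 2)) (max c ((a + c + d) / 2)) = (a + c + d) / 2 by omega,
    show min (min ((a + c + d) / 2) (a + c)) ((a + c + d) / 2) = (a + c + d) / 2 by omega,
    Finset.Icc_self, Finset.sum_singleton]
  rw [show (0 + a - a) / 2 = 0 by omega, show (a + a - 0) / 2 = a by omega, show (a + 0 - a) / 2 = 0 by omega,
    show (c + c - 0) / 2 = c by omega, show (0 + c - c) / 2 = 0 by omega,
    show (a + c + d) / 2 - (a + c + d) / 2 = 0 by omega,
    show (a + c + d) / 2 - a = (c + d - a) / 2 by omega, show (a + c + d) / 2 - c = (a + d - c) / 2 by omega,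
    show a + c - (a + c + d) / 2 = (a + c - d) / 2 by omega, qFactorial_zero, qFactorial_succ k a,
    qFactorial_succ k c]
  have hA : 0 < qFactorial k a := qFactorial_pos k (by omega)
  have hC : 0 < qFactorial k c := qFactorial_pos k (by omega)
  have hqa : 0 < qInt k (a + 1) := qInt_pos k (by omega) (by omega)
  have hqc : 0 < qInt k (c + 1) := qInt_pos k (by omega) (by omega)
  have hx : 0 < qFactorial k ((c + d - a) / 2) := qFactorial_pos k (by omega)
  have hy : 0 < qFactorial k ((a + d - c) / 2) := qFactorial_pos k (by omega)
  have hz : 0 < qFactorial k ((a + c - d) / 2) := qFactorial_pos k (by omega)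
  have hS : 0 < qFactorial k ((a + c + d) / 2 + 1) := qFactorial_pos k (by omega)
  generalize qFactorial k a = A at hA ⊢
  generalize qFactorial k c = C at hC ⊢
  generalize qInt k (a + 1) = qa at hqa ⊢
  generalize qInt k (c + 1) = qc at hqc ⊢
  generalize qFactorial k ((c + d - a) / 2) = x at hx ⊢
  generalize qFactorial k ((a + d - c) / 2) = y at hy ⊢
  generalize qFactorial k ((a + c - d) / 2) = z at hz ⊢
  generalize qFactorial k ((a + c + d) / 2 + 1) = S at hS ⊢
  rw [show 1 * A * 1 / (A * qa) * (x * y * z / S) * (C * 1 * 1 / (C * qc)) * (x * y * z / S) =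
      ((x * y * z / S) / Real.sqrt (qa * qc)) ^ 2 by
    rw [div_pow, Real.sq_sqrt (by positivity)]; field_simp, Real.sqrt_sq (by positivity)]
  field_simp

/-- Degenerate q-6j symbol with a unit third leg: `sixJ(a,b,d,0,d,b) = (-1)^{(a+b+d)/2}/√([d+1][b+1])`.
[cite: KauffmanLins1994, §9.11–9.12] -/
theorem sixJ_unit_right {a b d : ℕ} (h : Adm k a b d) (hb : b ≤ k) (hd : d ≤ k) :
    sixJ k a b d 0 d b = (-1 : ℝ) ^ ((a + b + d) / 2) / Real.sqrt (qInt k (d + 1) * qInt k (b + 1)) := by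
  have g := h
  unfold Adm at g
  unfold sixJ racahSum triangleSq
  simp only
  rw [show (d + 0 + d) / 2 = d by omega, show (b + 0 + b) / 2 = b by omega,
    show (a + b + 0 + d) / 2 = (a + b + d) / 2 by omega, show (a + d + 0 + b) / 2 = (a + b + d) / 2 by omega,
    show (b + d + d + b) / 2 = b + d by omega,
    show max (max ((a + b + d) / 2) d) (max b ((a + b + d) / 2)) = (a + b + d) / 2 by omega,
    show min (min ((a + b + d) / 2) ((a + b + d) / 2)) (b + d) = (a + b + d) / 2 by omega,
    Finset.Icc_self, Finset.sum_singleton]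
  rw [show (0 + d - d) / 2 = 0 by omega, show (d + d - 0) / 2 = d by omega, show (d + 0 - d) / 2 = 0 by omega,
    show (0 + b - b) / 2 = 0 by omega, show (b + b - 0) / 2 = b by omega, show (b + 0 - b) / 2 = 0 by omega,
    show (a + b + d) / 2 - (a + b + d) / 2 = 0 by omega,
    show (a + b + d) / 2 - d = (a + b - d) / 2 by omega, show (a + b + d) / 2 - b = (a + d - b) / 2 by omega,
    show b + d - (a + b + d) / 2 = (b + d - a) / 2 by omega, qFactorial_zero, qFactorial_succ k d,
    qFactorial_succ k b]
  have hB : 0 < qFactorial k b := qFactorial_pos k (by omega)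
  have hD : 0 < qFactorial k d := qFactorial_pos k (by omega)
  have hqb : 0 < qInt k (b + 1) := qInt_pos k (by omega) (by omega)
  have hqd : 0 < qInt k (d + 1) := qInt_pos k (by omega) (by omega)
  have hx : 0 < qFactorial k ((b + d - a) / 2) := qFactorial_pos k (by omega)
  have hy : 0 < qFactorial k ((a + d - b) / 2) := qFactorial_pos k (by omega)
  have hz : 0 < qFactorial k ((a + b - d) / 2) := qFactorial_pos k (by omega)
  have hS : 0 < qFactorial k ((a + b + d) / 2 + 1) := qFactorial_pos k (by omega)
  generalize qFactorial k b = B at hB ⊢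
  generalize qFactorial k d = D at hD ⊢
  generalize qInt k (b + 1) = qb at hqb ⊢
  generalize qInt k (d + 1) = qd at hqd ⊢
  generalize qFactorial k ((b + d - a) / 2) = x at hx ⊢
  generalize qFactorial k ((a + d - b) / 2) = y at hy ⊢
  generalize qFactorial k ((a + b - d) / 2) = z at hz ⊢
  generalize qFactorial k ((a + b + d) / 2 + 1) = S at hS ⊢
  rw [show x * y * z / S * (1 * D * 1 / (D * qd)) * (1 * B * 1 / (B * qb)) * (x * y * z / S) =
      ((x * y * z / S) / Real.sqrt (qd * qb)) ^ 2 by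
    rw [div_pow, Real.sq_sqrt (by positivity)]; field_simp, Real.sqrt_sq (by positivity)]
  field_simp

/-- The duality entry: `sixJ(a,a,0,a,a,0) = (-1)^a / [a+1]`. [cite: KauffmanLins1994, §9.11–9.12] -/
theorem sixJ_dual {a : ℕ} (ha : a ≤ k) : sixJ k a a 0 a a 0 = (-1 : ℝ) ^ a / qInt k (a + 1) := by
  unfold sixJ racahSum triangleSq
  simp only
  rw [show (a + a + 0) / 2 = a by omega, show (0 + a + a) / 2 = a by omega, show (a + 0 + a) / 2 = a by omega,
    show (a + a + a + a) / 2 = a + a by omega, show (a + 0 + a + 0) / 2 = a by omega,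
    show max (max a a) (max a a) = a by omega, show min (min (a + a) a) a = a by omega,
    Finset.Icc_self, Finset.sum_singleton]
  rw [show (a + 0 - a) / 2 = 0 by omega, show (a + a - 0) / 2 = a by omega, show (0 + a - a) / 2 = 0 by omega,
    show a - a = 0 by omega, show a + a - a = a by omega, qFactorial_zero, qFactorial_succ k a]
  have hA : 0 < qFactorial k a := qFactorial_pos k (by omega)
  have hqa : 0 < qInt k (a + 1) := qInt_pos k (by omega) (by omega)
  generalize qFactorial k a = A at hA ⊢
  generalize qInt k (a + 1) = qa at hqa ⊢
  rw [show 1 * 1 * A / (A * qa) * (A * 1 * 1 / (A * qa)) * (1 * 1 * A / (A * qa)) * (1 * A * 1 / (A * qa)) =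
      (1 / (qa * qa)) ^ 2 by field_simp, Real.sqrt_sq (by positivity)]
  field_simp

end Literature.RepresentationTheory.ModularTensorCategories.SU2LevelK

namespace Literature.RepresentationTheory.ModularTensorCategories.SU2LevelK

open Finset

variable (k : ℕ)

/-- **Trivial unit moves for the `SU(2)_k` F-symbols** (`PreModularDatum.F_unit` form): if one of
`a, b, c` is the unit label then `fSym = 1` on the admissible entry. [cite: KauffmanLins1994, §9.11–9.12] -/
theorem fSym_unit (a b c d e f : Fin (k + 1)) (h0 : a = 0 ∨ b = 0 ∨ c = 0)
    (hN : fusionN k a b e * fusionN k e c d * fusionN k b c f * fusionN k a f d ≠ 0) :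
    fSym k a b c d e f = 1 := by
  have hle : ∀ z : Fin (k + 1), (z : ℕ) ≤ k := fun z => Nat.lt_succ_iff.mp z.isLt
  simp only [ne_eq, mul_eq_zero, not_or] at hN
  obtain ⟨⟨⟨h1, h2⟩, h3⟩, h4⟩ := hN
  rw [← ne_eq, fusionN_ne_zero_iff] at h1 h2 h3 h4
  unfold fSym
  rw [if_pos ⟨h1, h2, h3, h4⟩]
  rcases h0 with rfl | rfl | rfl
  · -- a = 0 : e = b and f = d
    rw [Fin.val_zero] at h1 h4 ⊢
    have heb : (e : ℕ) = b := ((adm_zero_left k (hle b)).mp h1).symm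
    have hfd : (f : ℕ) = d := (adm_zero_left k (hle f)).mp h4
    have h2' : Adm k b c d := by rw [← heb]; exact h2
    rw [heb, hfd, sixJ_unit_left k h2' (hle b) (hle d)]
    have hq : 0 < qInt k (b + 1) * qInt k (d + 1) :=
      mul_pos (qInt_pos k (by omega) (by have := hle b; omega)) (qInt_pos k (by omega) (by have := hle d; omega))
    have hs : Real.sqrt (qInt k (b + 1) * qInt k (d + 1)) ≠ 0 := (Real.sqrt_pos.mpr hq).ne'
    have real_eq : (-1 : ℝ) ^ ((0 + (b : ℕ) + c + d) / 2) * Real.sqrt (qInt k (b + 1) * qInt k (d + 1)) *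
        ((-1 : ℝ) ^ (((b : ℕ) + c + d) / 2) / Real.sqrt (qInt k (b + 1) * qInt k (d + 1))) = 1 := by
      rw [show (0 + (b : ℕ) + c + d) / 2 = ((b : ℕ) + c + d) / 2 by rw [Nat.zero_add], mul_div_assoc',
        div_eq_one_iff_eq hs, mul_right_comm, ← pow_add, ← two_mul, pow_mul, neg_one_sq, one_pow, one_mul]
    exact_mod_cast real_eq
  · -- b = 0 : e = a and f = c
    rw [Fin.val_zero] at h1 h3 ⊢
    have hea : (e : ℕ) = a := (adm_zero_right k (hle a)).mp ((adm_swap k).mp h1)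
    have hfc : (f : ℕ) = c := ((adm_zero_left k (hle c)).mp h3).symm
    have h2' : Adm k a c d := by rw [← hea]; exact h2
    rw [hea, hfc, sixJ_unit_mid k h2' (hle a) (hle c)]
    have hq : 0 < qInt k (a + 1) * qInt k (c + 1) :=
      mul_pos (qInt_pos k (by omega) (by have := hle a; omega)) (qInt_pos k (by omega) (by have := hle c; omega))
    have hs : Real.sqrt (qInt k (a + 1) * qInt k (c + 1)) ≠ 0 := (Real.sqrt_pos.mpr hq).ne'
    have real_eq : (-1 : ℝ) ^ (((a : ℕ) + 0 + c + d) / 2) * Real.sqrt (qInt k (a + 1) * qInt k (c + 1)) *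
        ((-1 : ℝ) ^ (((a : ℕ) + c + d) / 2) / Real.sqrt (qInt k (a + 1) * qInt k (c + 1))) = 1 := by
      rw [show ((a : ℕ) + 0 + c + d) / 2 = ((a : ℕ) + c + d) / 2 by rw [Nat.add_zero], mul_div_assoc',
        div_eq_one_iff_eq hs, mul_right_comm, ← pow_add, ← two_mul, pow_mul, neg_one_sq, one_pow, one_mul]
    exact_mod_cast real_eq
  · -- c = 0 : f = b and e = d
    rw [Fin.val_zero] at h2 h3 ⊢
    have hfb : (f : ℕ) = b := (adm_zero_right k (hle b)).mp ((adm_swap k).mp h3)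
    have hed : (e : ℕ) = d := ((adm_zero_right k (hle e)).mp ((adm_swap k).mp h2)).symm
    have h1' : Adm k a b d := by rw [← hed]; exact h1
    rw [hfb, hed, sixJ_unit_right k h1' (hle b) (hle d)]
    have hq : 0 < qInt k (d + 1) * qInt k (b + 1) :=
      mul_pos (qInt_pos k (by omega) (by have := hle d; omega)) (qInt_pos k (by omega) (by have := hle b; omega))
    have hs : Real.sqrt (qInt k (d + 1) * qInt k (b + 1)) ≠ 0 := (Real.sqrt_pos.mpr hq).ne'
    have real_eq : (-1 : ℝ) ^ (((a : ℕ) + b + 0 + d) / 2) * Real.sqrt (qInt k (d + 1) * qInt k (b + 1)) *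
        ((-1 : ℝ) ^ (((a : ℕ) + b + d) / 2) / Real.sqrt (qInt k (d + 1) * qInt k (b + 1))) = 1 := by
      rw [show ((a : ℕ) + b + 0 + d) / 2 = ((a : ℕ) + b + d) / 2 by rw [Nat.add_zero], mul_div_assoc',
        div_eq_one_iff_eq hs, mul_right_comm, ← pow_add, ← two_mul, pow_mul, neg_one_sq, one_pow, one_mul]
    exact_mod_cast real_eq

/-- **Duality axiom for the `SU(2)_k` F-symbols** (`PreModularDatum.norm_F_dual` form):
`‖F^{aaa}_{a;00}‖ = 1/[a+1] = 1/d_a`. [cite: KauffmanLins1994, §9.11–9.12] -/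
theorem norm_fSym_dual (a : Fin (k + 1)) : ‖fSym k a a a a 0 0‖ = (qdim k a)⁻¹ := by
  have ha : (a : ℕ) ≤ k := Nat.lt_succ_iff.mp a.isLt
  have h1 : Adm k a a (0 : Fin (k + 1)) := by rw [Fin.val_zero, adm_zero_right k ha]
  have h2 : Adm k (0 : Fin (k + 1)) a a := by rw [Fin.val_zero, adm_zero_left k ha]
  have h4 : Adm k a (0 : Fin (k + 1)) a := (adm_swap k).mp h1
  unfold fSym
  rw [if_pos ⟨h1, h2, h1, h4⟩, Fin.val_zero, Complex.norm_real, Real.norm_eq_abs, sixJ_dual k ha,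
    Nat.zero_add, qInt_one, mul_one, Real.sqrt_one, mul_one]
  unfold qdim
  rw [abs_mul, abs_div, abs_pow, abs_pow, abs_neg, abs_one, one_pow, one_pow, one_mul, one_div,
    abs_of_pos (qInt_pos k (by omega) (by omega))]

end Literature.RepresentationTheory.ModularTensorCategories.SU2LevelK
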